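import Mathlib.Analysis.Complex.CauchyIntegral
import Mathlib.Analysis.Meromorphic.Order
import Mathlib.NumberTheory.LSeries.Injectivity
import Literature.NumberTheory.Automorphic.LanglandsTunnellProofs
import Literature.NumberTheory.Automorphic.LanglandsTunnellLSeriesProofs
import Literature.NumberTheory.Automorphic.ArtinLFunctions
import Literature.NumberTheory.EllipticCurves.Gamma1NewformLSeries
import Literature.NumberTheory.EllipticCurves.NewformGaloisRepProofs
import Literature.NumberTheory.LFunctions.FiniteEulerProducts
import Literature.NumberTheory.GaloisRepresentations.OddArtinRepGammaFactor
import Literature.NumberTheory.GaloisRepresentations.FramedRepDualProofs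
import Literature.NumberTheory.GaloisRepresentations.ArtinEulerProductProofs
import Literature.NumberTheory.GaloisRepresentations.HeckeCharacterProofs
import HarnessLib

/-!
# Deligne–Serre 1974, Thm. 4.6 (a): assembly of the proof (steps (i)–(iv))

This file **proves** the glue theorem of the decomposition of the named fact
`Literature.NumberTheory.Automorphic.artinConductorNat_eq_level` (Deligne–Serre, *Formes modulaires de poids 1*,
Ann. Sci. ÉNS (4) 7 (1974), Thm. 4.6 (a): the Artin conductor of the representation attached
to a weight-one newform of level `N` is `N`; top layer
`Literature.NumberTheory.Automorphic.LanglandsTunnellProofs`):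

* `Literature.NumberTheory.Automorphic.ModularForms.DeligneSerre1974.thm46a_of` —
  `rem45_isOdd → weightOne_functionalEquation → IsNewform1.cuspCoeff_of_dvd_level (k = 1) →
   Lang.artin_functional_equation (ℚ) → thm46a_artinConductorNat_eq`,
  i.e. Thm. 4.6 (a) (finite-image form, with Rem. 4.3) from the four printed inputs of its
  proof that are standard theorems not in Mathlib (named facts of the tree), op. cit.
  pp. 515–516: (i) the functional equation `Λ_f(1 - s) = a Λ_{f̃}(s)` of the newform
  (`weightOne_functionalEquation`) and the bound 1.8 (`|a_p| ≤ 1`, `p ∣ N`;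
  `IsNewform1.cuspCoeff_of_dvd_level`) — the Euler product (1.7.2) of `Φ_f` on `re s > 3/2`
  being *proved* (`IsNewform1.hasProd_cuspFormLSeries_holds_of_weight_one`, discharging the
  case `k = 1` of the named fact `IsNewform1.hasProd_cuspFormLSeries` of
  `Literature.NumberTheory.EllipticCurves.Gamma1NewformLSeries` from the Hecke relations proved
  in `Literature.NumberTheory.Automorphic.LanglandsTunnellLSeriesProofs`, the sibling file
  carrying Thm. 4.6 (b)); (ii) Artin's functional equation `Λ(1 - s, ρ) = W Λ(s, ρ^∨)`
  (`artin_functional_equation`), with the factor at infinity `Γ_ℂ(s)` of an odd `ρ` (Rem. 4.5,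
  `rem45_isOdd`; `FramedArtinRep.completedArtinLFunction_eq_of_isOdd`) and the same conductor
  `M` for `ρ` and `ρ^∨` (`FramedGaloisRep.artinConductorNat_dual`); (iii) the Euler product
  of `L(s, ρ)` (`Lang.artinLFunction_eulerProduct_holds`, proved in
  `Literature.NumberTheory.GaloisRepresentations.ArtinEulerProductProofs`) whose factors at
  `p ∤ N` are those of `Φ_f`
  by (4.1.1) (`ArtinRep.eulerFactorAt_eq_reverse_of_isUnramifiedAt`), and at `p ∣ N` are
  `∏ (1 - β p^{-s})` with `β` roots of unity (`ArtinRep.exists_eval_eulerFactorAt_eq_prod`);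
  (iv) Lemma 4.9 (`lemma49_holds`, proved).
* `Literature.NumberTheory.Automorphic.artinConductorNat_eq_level_of'` — the same hypotheses give the named fact
  `artinConductorNat_eq_level` itself (via `artinConductorNat_eq_level_of`).

## The argument (op. cit. (iii)–(iv)), as formalised

Write `S` for the set of primes dividing `N`, `E_p(T) = det(1 - T ρ(Frob_p) | V^{I_p})`,
`M = N 𝔣(ρ)`.  Comparing Euler products on `re s > 3/2` (`HasProd` over the primes, the two
products having the same factors off `S`; `Literature.NumberTheory.Automorphic.HasProd.mul_finset_prod_eq`) gives
`L(s, ρ) ∏_{p ∈ S} E_p(p^{-s}) = Φ_f(s) ∏_{p ∈ S} (1 - a_p p^{-s})` and the analogue for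
`ρ^∨` and `Φ_{f̃}(s) = Σ ā_n n^{-s}` (the Frobenius polynomials of `ρ^∨` are the complex
conjugates, `FramedGaloisRep.hasFrobCharpolyAt_dual`).  Multiplying by
`2 (MN)^{s/2} (2π)^{-s} Γ(s)`:
`N^{s/2} Λ_ρ(s) Num_G(s) = 2 M^{s/2} Λ_f(s) Den_G(s)` on `re s > 3/2`, where
`Num_G = ∏_{p ∈ S} E_p(p^{-s})`, `Den_G = ∏_{p ∈ S} (1 - a_p p^{-s})` are the numerator and
denominator of a finite Euler product (`Literature.NumberTheory.LFunctions.EulerFactorData`).  The meromorphic continuations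
(`Λ`, `Λ'` from Artin's functional equation, the entire `Λ_f`, `Λ_{f̃}` from (i)) turn these
into identities of meromorphic functions on `ℂ` vanishing on a half-plane, hence vanishing on
a punctured neighbourhood of every point (identity principle,
`Literature.NumberTheory.Automorphic.Meromorphic.eventually_eq_zero_of_eqOn_isOpen`); substituting the two functional
equations and eliminating `Λ'(s)` and `Λ_{f̃}(s) ≢ 0` (`Φ_{f̃}(x) → ā_1 = 1`,
Mathlib `LSeries.tendsto_atTop`) leaves an identity of *entire* functions
(`Literature.NumberTheory.Automorphic.ModularForms.DeligneSerre1974.crossIdentity_of_functionalEquations`), which is exactly the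
cross-multiplied functional equation (4.9.1) of Lemma 4.9 for `A = (N/M)^{1/2}`, `ω = a/W`
(`level_eq_conductor_of_crossIdentity`).  Lemma 4.9 applies since `|β| = 1 < p^{1/2}` and
`|a_p| ≤ 1 < p^{1/2}`, and gives `A = 1`, i.e. `M = N`.

## References

* P. Deligne, J.-P. Serre, *Formes modulaires de poids 1*, Ann. Sci. ÉNS (4) 7 (1974),
  507–530, doi:10.24033/asens.1277 — Thm. 4.6 and its proof, §4 (b) (i)–(iv), Lemma 4.9,
  pp. 514–516 (`DeligneSerreASENS1974`).
-/

noncomputable section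

open scoped MatrixGroups ModularForm NumberField
open Filter Topology Complex CongruenceSubgroup Field IsDedekindDomain NumberField Polynomial

namespace Literature.NumberTheory.Automorphic

/-! ### Analytic helpers -/

/-- Entire functions are meromorphic on `ℂ`. [folklore] -/
theorem meromorphic_of_differentiable {f : ℂ → ℂ} (hf : Differentiable ℂ f) : Meromorphic f :=
  fun x => (hf.analyticAt x).meromorphicAt

/-- **Identity principle for meromorphic functions on `ℂ`** in the form used below: a
meromorphic function on `ℂ` vanishing on a nonempty open set vanishes on a punctured
neighbourhood of every point.  Corollary of `Literature.NumberTheory.Automorphic.Meromorphic.eventually_nhdsNE_eq_zero`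
(`Literature.NumberTheory.Automorphic.LanglandsTunnellLSeriesProofs`: vanishing near one point
spreads, `ℂ` being connected). [folklore] -/
theorem Meromorphic.eventually_eq_zero_of_eqOn_isOpen {h : ℂ → ℂ} (hh : Meromorphic h)
    {O : Set ℂ} (hO : IsOpen O) (hne : O.Nonempty) (h0 : ∀ s ∈ O, h s = 0) (y : ℂ) :
    ∀ᶠ z in 𝓝[≠] y, h z = 0 := by
  obtain ⟨x₀, hx₀⟩ := hne
  exact Meromorphic.eventually_nhdsNE_eq_zero hh
    (by filter_upwards [hO.mem_nhds hx₀] with z hz using h0 z hz) y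

/-- An entire function which does not vanish identically is nonzero on a punctured
neighbourhood of every point (isolated zeros). [folklore] -/
theorem eventually_ne_zero_of_differentiable {f : ℂ → ℂ} (hf : Differentiable ℂ f) {w₀ : ℂ}
    (hw₀ : f w₀ ≠ 0) (y : ℂ) : ∀ᶠ z in 𝓝[≠] y, f z ≠ 0 := by
  rcases (hf.analyticAt y).eventually_eq_zero_or_eventually_ne_zero with h | h
  · exfalso
    apply hw₀
    exact (hf.differentiableOn.analyticOnNhd isOpen_univ).eqOn_zero_of_preconnected_of_eventuallyEq_zero
      isPreconnected_univ (Set.mem_univ y) h (Set.mem_univ w₀)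
  · exact h

/-- A continuous function vanishing on a punctured neighbourhood of `y` vanishes at `y`. [folklore] -/
theorem eq_zero_of_eventually_nhdsNE {Q : ℂ → ℂ} (hQ : Continuous Q) (y : ℂ)
    (h : ∀ᶠ z in 𝓝[≠] y, Q z = 0) : Q y = 0 :=
  tendsto_nhds_unique (hQ.continuousAt.tendsto.mono_left nhdsWithin_le_nhds)
    (tendsto_const_nhds.congr' (h.mono fun _ hz => hz.symm))

/-- For positive real `x`, `x^{s/2} = (√x)^s` (principal powers). [folklore] -/
theorem ofReal_cpow_half {x : ℝ} (hx : 0 < x) (s : ℂ) :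
    (x : ℂ) ^ (s / 2) = ((Real.sqrt x : ℝ) : ℂ) ^ s := by
  have hx0 : (x : ℂ) ≠ 0 := ofReal_ne_zero.mpr hx.ne'
  have hsq : ((Real.sqrt x : ℝ) : ℂ) ≠ 0 := ofReal_ne_zero.mpr (Real.sqrt_pos.mpr hx).ne'
  rw [cpow_def_of_ne_zero hx0, cpow_def_of_ne_zero hsq, ← ofReal_log hx.le,
    ← ofReal_log (Real.sqrt_nonneg x), Real.log_sqrt hx.le]
  congr 1
  push_cast
  ring

/-- **Comparing two convergent products with the same factors off a finite set.**  If
`∏ f = a` and `∏ g = b` (as `HasProd` over the same index type) and `f = g` outside the finite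
set `T`, then `a ∏_{T} g = b ∏_{T} f` (no division: multiply each product by the finitely
supported correction of the other).  Ref: Deligne–Serre 1974, §4 (b) (iii) ("les facteurs
locaux de `Φ_f(s)` et de `L(s, ρ)` … sont les mêmes pour `p ∤ N`; on a donc
`F(s) = A^s ∏_{p ∣ N} F_p(s)`"). [folklore] -/
theorem HasProd.mul_finset_prod_eq {ι : Type*} [DecidableEq ι] {f g : ι → ℂ} {a b : ℂ}
    (hf : HasProd f a) (hg : HasProd g b) (T : Finset ι) (hfg : ∀ i ∉ T, f i = g i) :
    a * ∏ i ∈ T, g i = b * ∏ i ∈ T, f i := by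
  have h1 : HasProd (fun i => if i ∈ T then g i else 1) (∏ i ∈ T, g i) := by
    have h : HasProd (fun i => if i ∈ T then g i else 1) (∏ i ∈ T, if i ∈ T then g i else 1) :=
      hasProd_prod_of_ne_finset_one fun i hi => if_neg hi
    rwa [Finset.prod_congr rfl fun i hi => if_pos hi] at h
  have h2 : HasProd (fun i => if i ∈ T then f i else 1) (∏ i ∈ T, f i) := by
    have h : HasProd (fun i => if i ∈ T then f i else 1) (∏ i ∈ T, if i ∈ T then f i else 1) :=
      hasProd_prod_of_ne_finset_one fun i hi => if_neg hi
    rwa [Finset.prod_congr rfl fun i hi => if_pos hi] at h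
  have e : (fun i => f i * (if i ∈ T then g i else 1)) = fun i => g i * (if i ∈ T then f i else 1) := by
    funext i
    split_ifs with hi
    · ring
    · rw [hfg i hi]
  have hA := hf.mul h1
  rw [e] at hA
  exact hA.unique (hg.mul h2)

/-! ### Places of `ℚ` and Euler factors at a rational prime -/

namespace Rat

open Rat.HeightOneSpectrum

/-- The finite place of `ℚ` under the natural number `p`: `Lang.placeOfPrime p _`
(`Literature.NumberTheory.Automorphic.LanglandsTunnellLSeriesProofs`, the inverse of Mathlib's
`Rat.HeightOneSpectrum.primesEquiv`) when `p` is prime, extended by a junk value (the place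
of `2`) to all of `ℕ`, so that Euler factors can be indexed by `p : ℕ` (`Finset` products over
`N.primeFactors`, `HasProd` over `Nat.Primes` via the coercion) without threading primality
proofs. [folklore] -/
def placeOf (p : ℕ) : HeightOneSpectrum (𝓞 ℚ) :=
  if hp : p.Prime then Automorphic.placeOfPrime p hp else Automorphic.placeOfPrime 2 Nat.prime_two

/-- For a prime `p`, `placeOf p` is `Lang.placeOfPrime p`. [folklore] -/
@[simp] theorem placeOf_eq_placeOfPrime {p : ℕ} (hp : p.Prime) :
    placeOf p = Automorphic.placeOfPrime p hp := by
  rw [placeOf, dif_pos hp]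

/-- The residue field of the place of `ℚ` corresponding to the prime `p` has `p` elements. [folklore] -/
theorem residueCard_primesEquiv_symm (p : Nat.Primes) :
    (primesEquiv.symm p : HeightOneSpectrum (𝓞 ℚ)).residueCard = p := by
  rw [Literature.NumberTheory.GaloisRepresentations.Rat.residueCard_eq_natGenerator]
  exact congrArg Subtype.val (primesEquiv.apply_symm_apply p)

end Rat

/-- The finite set of primes dividing `N`, as a `Finset` of `Nat.Primes`. [folklore] -/
def primesDividing (N : ℕ) : Finset Nat.Primes :=
  N.primeFactors.attach.map
    ⟨fun q => ⟨q.1, Nat.prime_of_mem_primeFactors q.2⟩, fun a b h => Subtype.ext (by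
      simpa using congrArg Subtype.val h)⟩

/-- Membership in `primesDividing N` (`N ≠ 0`). [folklore] -/
theorem mem_primesDividing {N : ℕ} (hN : N ≠ 0) {p : Nat.Primes} :
    p ∈ primesDividing N ↔ (p : ℕ) ∣ N := by
  simp only [primesDividing, Finset.mem_map, Finset.mem_attach, Function.Embedding.coeFn_mk,
    true_and, Subtype.exists, Nat.mem_primeFactors]
  constructor
  · rintro ⟨q, ⟨-, hq, -⟩, rfl⟩
    exact hq
  · intro h
    exact ⟨p, ⟨p.2, h, hN⟩, Subtype.ext rfl⟩

/-- A product over `primesDividing N` is the product over `N.primeFactors`. [folklore] -/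
theorem prod_primesDividing {N : ℕ} (F : ℕ → ℂ) :
    ∏ p ∈ primesDividing N, F p = ∏ p ∈ N.primeFactors, F p := by
  rw [primesDividing, Finset.prod_map]
  exact Finset.prod_attach N.primeFactors F

section FramedArtinRep
open Literature.NumberTheory.GaloisRepresentations (FramedArtinRep)
open Literature.NumberTheory.GaloisRepresentations.FramedArtinRep

open Rat.HeightOneSpectrum

/-- The Euler factor of `ρ : Γ_ℚ → GL_n(ℂ)` at the rational prime `p`, evaluated at `p^{-s}`:
`E_p(p^{-s}) = det(1 - p^{-s} ρ(Frob_p) | V^{I_p})` (`ArtinRep.eulerFactorAt` at the place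
`Rat.placeOf p`). [folklore] -/
def _root_.Literature.NumberTheory.GaloisRepresentations.FramedArtinRep.eulerEval {n : ℕ} (ρ : FramedArtinRep ℚ n) (p : ℕ) (s : ℂ) : ℂ :=
  (ρ.toArtinRep.eulerFactorAt (Rat.placeOf p)).eval ((p : ℂ) ^ (-s))

/-- **(iii), Euler product over the rational primes.**  For `re s > 1`,
`L(s, ρ) = ∏_p E_p(p^{-s})⁻¹` as a convergent product over `Nat.Primes`
(`Lang.artinLFunction_eulerProduct_holds`, reindexed by `primesEquiv`, with `N v = p`).
[cite: DeligneSerreASENS1974, §4 (b) proof of Thm. 4.6 (iii)] -/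
theorem _root_.Literature.NumberTheory.GaloisRepresentations.FramedArtinRep.hasProd_eulerEval {n : ℕ} (ρ : FramedArtinRep ℚ n) {s : ℂ} (hs : 1 < s.re) :
    HasProd (fun p : Nat.Primes => (eulerEval ρ p s)⁻¹) (GaloisRepresentations.artinLFunction ρ.toArtinRep s) := by
  have h := GaloisRepresentations.artinLFunction_eulerProduct_holds ρ.toArtinRep hs
  rw [← (primesEquiv (R := 𝓞 ℚ)).symm.hasProd_iff] at h
  refine h.congr_fun fun p => ?_
  simp only [Function.comp_apply, eulerEval, Rat.placeOf_eq_placeOfPrime p.2, Automorphic.placeOfPrime,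
    Subtype.coe_eta, Rat.residueCard_primesEquiv_symm]

end FramedArtinRep

namespace ModularForms

variable {N : ℕ} [NeZero N]

/-! ### The newform side: Euler factors, conjugate series -/

/-- The Euler factor `1 - a_p p^{-s} + ε(p) p^{-2s}` of `Φ_f` in weight one
(`= 1 - a_p p^{-s}` for `p ∣ N`, where `ε(p) = 0`).
Ref: Deligne–Serre 1974, (1.7.2). [cite: DeligneSerreASENS1974, (1.7.2)] -/
def newformEulerEval (f : CuspForm (Gamma1 N) 1) (p : ℕ) (s : ℂ) : ℂ :=
  1 - EllipticCurves.ModularForms.cuspCoeff f p * (p : ℂ) ^ (-s) + EllipticCurves.ModularForms.nebentypus f (p : ZMod N) * ((p : ℂ) ^ (-s)) ^ 2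

/-- The Euler factor `1 - ā_p p^{-s} + ε̄(p) p^{-2s}` of `Φ_{f̃}`, `f̃ = Σ ā_n qⁿ`.
Ref: Deligne–Serre 1974, §4 (b) (iii). [cite: DeligneSerreASENS1974, §4 (b) proof of Thm. 4.6 (iii)] -/
def conjNewformEulerEval (f : CuspForm (Gamma1 N) 1) (p : ℕ) (s : ℂ) : ℂ :=
  1 - (starRingEnd ℂ) (EllipticCurves.ModularForms.cuspCoeff f p) * (p : ℂ) ^ (-s) +
    (starRingEnd ℂ) (EllipticCurves.ModularForms.nebentypus f (p : ZMod N)) * ((p : ℂ) ^ (-s)) ^ 2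

/-- `x^{k - 1 - 2s} = (x^{-s})²` in weight `k = 1` (`x ≠ 0`). [folklore] -/
theorem cpow_weightOne_eq_sq {x : ℂ} (hx : x ≠ 0) (s : ℂ) :
    x ^ (((1 : ℤ) : ℂ) - 1 - 2 * s) = (x ^ (-s)) ^ 2 := by
  rw [sq, ← Complex.cpow_add _ _ hx]
  congr 1
  push_cast
  ring

/-- **(1.7.2) in weight one, discharged**: the case `k = 1` of the named fact
`IsNewform1.hasProd_cuspFormLSeries` (`Literature.NumberTheory.EllipticCurves.Gamma1NewformLSeries`):
for a newform `f ∈ S_1(Γ₁(N))` and `re s > 3/2`,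
`Φ_f(s) = ∏_p (1 - a_p p^{-s} + ε(p) p^{1 - 1 - 2s})⁻¹` (`HasProd` over the primes).  From the
Hecke relations of a newform (Diamond–Shurman Prop. 5.8.5 (2), (3)), proved in
`Literature.NumberTheory.Automorphic.LanglandsTunnellLSeriesProofs`
(`IsNewform1.cuspCoeff_mul_of_coprime_holds`, `IsNewform1.cuspCoeff_prime_pow_add_two_holds`,
`hasProd_cuspFormLSeries_of_hecke`), and `p^{k - 1 - 2s} = (p^{-s})²` in weight one.
[cite: DeligneSerreASENS1974, (1.7.2)] -/
theorem _root_.Literature.NumberTheory.EllipticCurves.ModularForms.IsNewform1.hasProd_cuspFormLSeries_holds_of_weight_one :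
    EllipticCurves.ModularForms.IsNewform1.hasProd_cuspFormLSeries (N := N) (k := 1) := by
  intro f hf s hs
  have hs' : 3 / 2 < s.re := by push_cast at hs; linarith
  refine (hasProd_cuspFormLSeries_of_hecke hf (EllipticCurves.ModularForms.IsNewform1.cuspCoeff_mul_of_coprime_holds hf)
    (EllipticCurves.ModularForms.IsNewform1.cuspCoeff_prime_pow_add_two_holds.weight_one hf) hs').congr_fun fun p => ?_
  rw [cpow_weightOne_eq_sq (Nat.cast_ne_zero.mpr p.2.ne_zero)]

/-- (1.7.2) in weight one, in the normalised form `Φ_f(s) = ∏_p (1 - a_p p^{-s} + ε(p) p^{-2s})⁻¹`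
(`re s > 3/2`; `hasProd_cuspFormLSeries_of_hecke` of
`Literature.NumberTheory.Automorphic.LanglandsTunnellLSeriesProofs` with the Hecke relations
proved there; restated for the named Euler factor `newformEulerEval`).
[cite: DeligneSerreASENS1974, (1.7.2)] -/
theorem hasProd_newformEulerEval {f : CuspForm (Gamma1 N) 1} (hf : EllipticCurves.ModularForms.IsNewform1 f) {s : ℂ}
    (hs : 3 / 2 < s.re) :
    HasProd (fun p : Nat.Primes => (newformEulerEval f p s)⁻¹) (EllipticCurves.ModularForms.cuspFormLSeries f s) :=
  hasProd_cuspFormLSeries_of_hecke hf (EllipticCurves.ModularForms.IsNewform1.cuspCoeff_mul_of_coprime_holds hf)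
    (EllipticCurves.ModularForms.IsNewform1.cuspCoeff_prime_pow_add_two_holds.weight_one hf) hs

/-- Euler product of `Φ_{f̃}`: `Φ_{f̃}(s) = ∏_p (1 - ā_p p^{-s} + ε̄(p) p^{-2s})⁻¹` for
`re s > 3/2` (`hasProd_conjCuspFormLSeries_of_hecke` of
`Literature.NumberTheory.Automorphic.LanglandsTunnellLSeriesProofs`, fed with the Hecke relations
proved there; restated for the named Euler factor `conjNewformEulerEval`).
Ref: Deligne–Serre 1974, §4 (b) (iii) (`F̃(s) = A^s ∏ F̃_p(s)` "en notant `z ↦ F̃_p(z)` la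
fonction déduite de `F_p(z)` par conjugaison complexe (des coefficients)").
[cite: DeligneSerreASENS1974, §4 (b) proof of Thm. 4.6 (iii)] -/
theorem hasProd_conjNewformEulerEval {f : CuspForm (Gamma1 N) 1} (hf : EllipticCurves.ModularForms.IsNewform1 f) {s : ℂ}
    (hs : 3 / 2 < s.re) :
    HasProd (fun p : Nat.Primes => (conjNewformEulerEval f p s)⁻¹) (EllipticCurves.ModularForms.conjCuspFormLSeries f s) :=
  hasProd_conjCuspFormLSeries_of_hecke hf (EllipticCurves.ModularForms.IsNewform1.cuspCoeff_mul_of_coprime_holds hf)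
    (EllipticCurves.ModularForms.IsNewform1.cuspCoeff_prime_pow_add_two_holds.weight_one hf) hs

/-- `Φ_{f̃}` does not vanish identically on `re s > 3/2` (`a_1 = 1` for a newform;
`exists_lt_re_LSeries_ne_zero` of
`Literature.NumberTheory.Automorphic.LanglandsTunnellLSeriesProofs`). [folklore] -/
theorem exists_conjCuspFormLSeries_ne_zero {f : CuspForm (Gamma1 N) 1} (hf : EllipticCurves.ModularForms.IsNewform1 f) :
    ∃ x : ℝ, 3 / 2 < x ∧ EllipticCurves.ModularForms.conjCuspFormLSeries f x ≠ 0 := by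
  have h1 : (starRingEnd ℂ) (EllipticCurves.ModularForms.cuspCoeff f 1) ≠ 0 := by
    rw [(EllipticCurves.ModularForms.isNormalized_iff_cuspCoeff_one f).mp hf.2.2.2, map_one]; exact one_ne_zero
  obtain ⟨x, hx, hx0⟩ := exists_lt_re_LSeries_ne_zero h1
    (EllipticCurves.ModularForms.LSeriesSummable_conj_cuspCoeff (strictWidthInfty_Gamma1 N) f (s := 2) (by norm_num)) (3 / 2)
  exact ⟨x, hx, by rwa [EllipticCurves.ModularForms.conjCuspFormLSeries_def]⟩

namespace DeligneSerre1974

open Rat.HeightOneSpectrum GaloisRepresentations.FramedArtinRep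

variable {f : CuspForm (Gamma1 N) 1} {ρ : GaloisRepresentations.FramedGaloisRep ℚ ℂ 2}

/-- **(4.1.1) ⇒ equal Euler factors at `p ∤ N`.**  If `ρ` is attached to `f` away from `N`
then for a prime `p ∤ N`, `E_p(p^{-s}) = 1 - a_p p^{-s} + ε(p) p^{-2s}`: `ρ` is unramified at
`p` with `charpoly ρ(Frob_p) = X² - a_p X + ε(p)`, and `det(1 - T Frob_p) = 1 - a_p T + ε(p) T²`
(`ArtinRep.eulerFactorAt_eq_reverse_of_isUnramifiedAt`, `eval_reverse_X_sq_sub_add`).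
Ref: Deligne–Serre 1974, §4 (b) (iii). [cite: DeligneSerreASENS1974, §4 (b) proof of Thm. 4.6 (iii)] -/
theorem eulerEval_eq_newformEulerEval
    (hρ : EllipticCurves.ModularForms.IsGaloisRepOfNewform1 f (algebraMap (EllipticCurves.ModularForms.coeffCharField f) ℂ) {p | p ∣ N} ρ)
    {p : ℕ} (hp : p.Prime) (hpN : ¬p ∣ N) (s : ℂ) :
    eulerEval ρ p s = newformEulerEval f p s := by
  have hplace : Rat.placeOf p = primesEquiv.symm ⟨p, hp⟩ := Rat.placeOf_eq_placeOfPrime hp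
  have h := hρ (primesEquiv.symm ⟨p, hp⟩)
  simp only [Equiv.apply_symm_apply] at h
  obtain ⟨hur, hP⟩ := h hpN
  rw [eulerEval, hplace, GaloisRepresentations.ArtinRep.eulerFactorAt_eq_reverse_of_isUnramifiedAt
    (GaloisRepresentations.FramedArtinRep.toArtinRep ρ) ((GaloisRepresentations.FramedGaloisRep.isUnramifiedAt_toGaloisRep_iff _ ρ).mpr hur)
    ((GaloisRepresentations.FramedGaloisRep.hasFrobCharpolyAt_toGaloisRep_iff _ _ ρ).mpr hP), EllipticCurves.ModularForms.map_heckePolynomial,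
    GaloisRepresentations.eval_reverse_X_sq_sub_add, newformEulerEval, sub_self, zpow_zero, mul_one]
  rfl

/-- **The same for `ρ^∨` and `f̃`** (finite image): for `p ∤ N`,
`E_p^∨(p^{-s}) = 1 - ā_p p^{-s} + ε̄(p) p^{-2s}`, the Frobenius polynomial of `ρ^∨` being
`X² - ā_p X + ε̄(p)` (`FramedGaloisRep.hasFrobCharpolyAt_dual`).
Ref: Deligne–Serre 1974, §4 (b) (ii)–(iii) (`ρ̄`, `F̃_p`). [cite: DeligneSerreASENS1974, §4 (b) proof of Thm. 4.6 (iii)] -/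
theorem eulerEval_dual_eq_conjNewformEulerEval
    (hρ : EllipticCurves.ModularForms.IsGaloisRepOfNewform1 f (algebraMap (EllipticCurves.ModularForms.coeffCharField f) ℂ) {p | p ∣ N} ρ)
    (hfin : (Set.range ρ).Finite) {p : ℕ} (hp : p.Prime) (hpN : ¬p ∣ N) (s : ℂ) :
    eulerEval (GaloisRepresentations.FramedRep.dual ρ) p s = conjNewformEulerEval f p s := by
  have hplace : Rat.placeOf p = primesEquiv.symm ⟨p, hp⟩ := Rat.placeOf_eq_placeOfPrime hp
  have h := hρ (primesEquiv.symm ⟨p, hp⟩)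
  simp only [Equiv.apply_symm_apply] at h
  obtain ⟨hur, hP⟩ := h hpN
  have hur' := GaloisRepresentations.FramedGaloisRep.isUnramifiedAt_dual hur
  have hP' := GaloisRepresentations.FramedGaloisRep.hasFrobCharpolyAt_dual hfin hP
  rw [EllipticCurves.ModularForms.map_heckePolynomial] at hP'
  simp only [Polynomial.map_add, Polynomial.map_sub, Polynomial.map_mul, Polynomial.map_pow,
    map_X, map_C] at hP'
  rw [eulerEval, hplace, GaloisRepresentations.ArtinRep.eulerFactorAt_eq_reverse_of_isUnramifiedAt
    (GaloisRepresentations.FramedArtinRep.toArtinRep (GaloisRepresentations.FramedRep.dual ρ))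
    ((GaloisRepresentations.FramedGaloisRep.isUnramifiedAt_toGaloisRep_iff _ _).mpr hur')
    ((GaloisRepresentations.FramedGaloisRep.hasFrobCharpolyAt_toGaloisRep_iff _ _ _).mpr hP'),
    GaloisRepresentations.eval_reverse_X_sq_sub_add, conjNewformEulerEval, sub_self, zpow_zero, mul_one]
  rfl

/-- **(iii): comparison of `L(s, ρ)` with a Dirichlet series having the same Euler factors
off `N`.**  If `∏_p E_p(p^{-s})⁻¹ = L` and `∏_p (1 - c_p p^{-s} + e_p p^{-2s})⁻¹ = Φ`
(convergent products over the primes), the factors agree at `p ∤ N`, `e_p = 0` for `p ∣ N`,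
and the factors at `p ∣ N` do not vanish, then
`L ∏_{p ∣ N} E_p(p^{-s}) = Φ ∏_{p ∣ N} (1 - c_p p^{-s})`.
Relation to `Lang.artinLFunction_mul_finiteEulerNum_eq` of
`Literature.NumberTheory.Automorphic.LanglandsTunnellLSeriesProofs` (the same step (iii)): that
theorem is phrased for the packaged local data `Lang.dsLocalData` (an `EulerFactorData` whose
numerator is `ArtinRep.exists_eulerFactorAt_eq_prod`'s multiset) and concludes with
`finiteEulerNum`/`finiteEulerDen`; the present form is stated directly for two `HasProd`
identities over `Nat.Primes` with abstract coefficients `c, e`, which is how both the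
`(f, ρ)` and the `(f̃, ρ^∨)` comparisons are consumed by `thm46a_of` (the local data of
Thm. 4.6 (a) are built from the *evaluated* factors `ArtinRep.exists_eval_eulerFactorAt_eq_prod`).
Not merged with the sibling form for this reason (librarian: the two are inter-derivable).
Ref: Deligne–Serre 1974, §4 (b) (iii) (`F(s) = A^s ∏_{p ∣ N} F_p(s)`,
`F_p = (1 - b_p p^{-s})(1 - c_p p^{-s})/(1 - a_p p^{-s})`). [cite: DeligneSerreASENS1974, §4 (b) proof of Thm. 4.6 (iii)] -/
theorem artin_mul_prod_eq {ρ' : GaloisRepresentations.FramedArtinRep ℚ 2} {c e : ℕ → ℂ} {L Φ s : ℂ}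
    (hL : HasProd (fun p : Nat.Primes => (eulerEval ρ' p s)⁻¹) L)
    (hΦ : HasProd (fun p : Nat.Primes =>
      (1 - c p * (p : ℂ) ^ (-s) + e p * ((p : ℂ) ^ (-s)) ^ 2)⁻¹) Φ)
    (hagree : ∀ p : ℕ, p.Prime → ¬p ∣ N →
      eulerEval ρ' p s = 1 - c p * (p : ℂ) ^ (-s) + e p * ((p : ℂ) ^ (-s)) ^ 2)
    (he : ∀ p : ℕ, p.Prime → p ∣ N → e p = 0)
    (hE0 : ∀ p ∈ N.primeFactors, eulerEval ρ' p s ≠ 0)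
    (hc0 : ∀ p ∈ N.primeFactors, 1 - c p * (p : ℂ) ^ (-s) ≠ 0) :
    L * ∏ p ∈ N.primeFactors, eulerEval ρ' p s =
      Φ * ∏ p ∈ N.primeFactors, (1 - c p * (p : ℂ) ^ (-s)) := by
  classical
  have hN : N ≠ 0 := NeZero.ne N
  have key := HasProd.mul_finset_prod_eq hL hΦ (primesDividing N) fun p hp => by
    rw [mem_primesDividing hN] at hp
    rw [hagree p p.2 hp]
  rw [prod_primesDividing (F := fun p => (1 - c p * (p : ℂ) ^ (-s) + e p * ((p : ℂ) ^ (-s)) ^ 2)⁻¹),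
    prod_primesDividing (F := fun p => (eulerEval ρ' p s)⁻¹)] at key
  have hε : ∏ p ∈ N.primeFactors, (1 - c p * (p : ℂ) ^ (-s) + e p * ((p : ℂ) ^ (-s)) ^ 2)⁻¹ =
      ∏ p ∈ N.primeFactors, (1 - c p * (p : ℂ) ^ (-s))⁻¹ :=
    Finset.prod_congr rfl fun p hp => by
      rw [he p (Nat.prime_of_mem_primeFactors hp) (Nat.dvd_of_mem_primeFactors hp), zero_mul,
        add_zero]
  rw [hε, Finset.prod_inv_distrib, Finset.prod_inv_distrib] at key
  have hA : ∏ p ∈ N.primeFactors, eulerEval ρ' p s ≠ 0 := Finset.prod_ne_zero_iff.mpr hE0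
  have hB : ∏ p ∈ N.primeFactors, (1 - c p * (p : ℂ) ^ (-s)) ≠ 0 := Finset.prod_ne_zero_iff.mpr hc0
  field_simp at key
  linear_combination key

/-- An Euler term `1 - α p^{-s}` with `|α| ≤ 1`, `p ≥ 2`, `re s > 0` does not vanish
(`|α p^{-s}| < 1`). [folklore] -/
theorem eulerTerm_ne_zero_of_norm_le_one {p : ℕ} (hp : 2 ≤ p) {α s : ℂ} (hα : ‖α‖ ≤ 1)
    (hs : 0 < s.re) : LFunctions.eulerTerm p α s ≠ 0 := by
  intro h
  have h1 := LFunctions.norm_eq_rpow_of_eulerTerm_eq_zero (by omega) h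
  have h2 : (1 : ℝ) < (p : ℝ) ^ s.re :=
    Real.one_lt_rpow (by exact_mod_cast (by omega : 1 < p)) hs
  linarith

/-! ### Steps (i)–(iv): the analytic core -/

/-- **Elimination of the L-functions** (Deligne–Serre 1974, proof of Thm. 4.6, (iii)–(iv), the
passage "on a `F(1 - s) = ω F̃(s)`" made division-free).  Let `Λ'` be meromorphic and `E_c`
entire on `ℂ` (the continuations of `Λ(s, ρ^∨)` and `Λ_{f̃}`), `n_G, d_G, n_H, d_H` entire
(numerators/denominators of the finite Euler products), `c_N, c_M ≠ 0`, and suppose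
(B1) `c_N^{s/2} Λ(s) n_G(s) = 2 c_M^{s/2} E_f(s) d_G(s)` and
(B2) `c_N^{s/2} Λ'(s) n_H(s) = 2 c_M^{s/2} E_c(s) d_H(s)` for `re s > 3/2`, together with the
functional equations `Λ(1 - s) = W Λ'(s)`, `E_f(1 - s) = a E_c(s)` for all `s`, and
`E_c ≢ 0`.  Then for **all** `s`:
`W c_N^{(1-s)/2} c_M^{s/2} n_G(1-s) d_H(s) = a c_M^{(1-s)/2} c_N^{s/2} d_G(1-s) n_H(s)`.
Proof: (B1) at `1 - s`, rewritten through the functional equations, and (B2) are identities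
of meromorphic functions of `s` on half-planes, hence hold on a punctured neighbourhood of
every point (identity principle); eliminating `Λ'(s)` gives `2 E_c(s) Q(s) = 0` with `Q` the
difference of the two sides, so the entire function `Q` vanishes off the (isolated) zeros of
`E_c` near every point, hence everywhere by continuity.
Relation to `dsStar_identity` of
`Literature.NumberTheory.Automorphic.LanglandsTunnellLSeriesProofs` (the (★)-identity of the
sibling proof of Thm. 4.6 (b)): `dsStar_identity` keeps two conductors `M, M' : ℕ` and natural
bases and asks meromorphy of `Λ`; the present statement is the form needed once
`M' = M` is known (`FramedGaloisRep.artinConductorNat_dual`, the point of Thm. 4.6 (a)), with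
the bases as nonzero complex constants `c_N, c_M` (so that `level_eq_conductor_of_crossIdentity`
can read off `A = (N/M)^{1/2}` for Lemma 4.9 (1), `A = 1`) and meromorphy asked of `Λ'`, the
function that is actually eliminated.  Kept separate for these reasons (librarian: a common
generalisation exists but is not in the tree).
[cite: DeligneSerreASENS1974, §4 (b) proof of Thm. 4.6 (iii)–(iv)] -/
theorem crossIdentity_of_functionalEquations {cN cM : ℂ} (hcN : cN ≠ 0) (hcM : cM ≠ 0)
    {Λ Λ' Ef Ec nG dG nH dH : ℂ → ℂ} (hΛ' : Meromorphic Λ') (hEc : Differentiable ℂ Ec)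
    (hnG : Differentiable ℂ nG) (hdG : Differentiable ℂ dG) (hnH : Differentiable ℂ nH)
    (hdH : Differentiable ℂ dH) {a W : ℂ}
    (hB1 : ∀ s : ℂ, 3 / 2 < s.re → cN ^ (s / 2) * Λ s * nG s = 2 * cM ^ (s / 2) * Ef s * dG s)
    (hB2 : ∀ s : ℂ, 3 / 2 < s.re → cN ^ (s / 2) * Λ' s * nH s = 2 * cM ^ (s / 2) * Ec s * dH s)
    (hFEA : ∀ s, Λ (1 - s) = W * Λ' s) (hfe : ∀ s, Ef (1 - s) = a * Ec s)
    (hEc0 : ∃ w, Ec w ≠ 0) (s : ℂ) :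
    W * cN ^ ((1 - s) / 2) * cM ^ (s / 2) * nG (1 - s) * dH s =
      a * cM ^ ((1 - s) / 2) * cN ^ (s / 2) * dG (1 - s) * nH s := by
  obtain ⟨w₀, hw₀⟩ := hEc0
  -- entire building blocks
  have hsub : Differentiable ℂ (fun w : ℂ => 1 - w) := (differentiable_const 1).sub differentiable_id
  have hpN : Differentiable ℂ (fun w : ℂ => cN ^ (w / 2)) :=
    (differentiable_id.div_const 2).const_cpow (Or.inl hcN)
  have hpM : Differentiable ℂ (fun w : ℂ => cM ^ (w / 2)) :=
    (differentiable_id.div_const 2).const_cpow (Or.inl hcM)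
  have hpN' : Differentiable ℂ (fun w : ℂ => cN ^ ((1 - w) / 2)) :=
    (hsub.div_const 2).const_cpow (Or.inl hcN)
  have hpM' : Differentiable ℂ (fun w : ℂ => cM ^ ((1 - w) / 2)) :=
    (hsub.div_const 2).const_cpow (Or.inl hcM)
  have hnG' : Differentiable ℂ (fun w => nG (1 - w)) := hnG.comp hsub
  have hdG' : Differentiable ℂ (fun w => dG (1 - w)) := hdG.comp hsub
  -- (B1) at `1 - w`, through the functional equations: a meromorphic function of `w`
  set G₁ : ℂ → ℂ := fun w =>
    cN ^ ((1 - w) / 2) * (W * Λ' w) * nG (1 - w) - 2 * cM ^ ((1 - w) / 2) * (a * Ec w) * dG (1 - w)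
    with hG₁
  have hG₁m : Meromorphic G₁ :=
    (((meromorphic_of_differentiable hpN').mul ((Meromorphic.const W).mul hΛ')).mul
      (meromorphic_of_differentiable hnG')).sub
      ((((Meromorphic.const 2).mul (meromorphic_of_differentiable hpM')).mul
        ((Meromorphic.const a).mul (meromorphic_of_differentiable hEc))).mul
        (meromorphic_of_differentiable hdG'))
  have hG₁z : ∀ w ∈ {w : ℂ | w.re < -1 / 2}, G₁ w = 0 := fun w hw => by
    have h := hB1 (1 - w) (by simp only [Set.mem_setOf_eq] at hw; simp; linarith)
    rw [hFEA, hfe] at h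
    simp only [hG₁]
    exact sub_eq_zero.mpr h
  have hev₁ : ∀ y, ∀ᶠ w in 𝓝[≠] y, G₁ w = 0 :=
    Meromorphic.eventually_eq_zero_of_eqOn_isOpen hG₁m (O := {w : ℂ | w.re < -1 / 2})
      (isOpen_lt Complex.continuous_re continuous_const) ⟨-1, by norm_num⟩ hG₁z
  -- (B2): a meromorphic function of `w`
  set G₂ : ℂ → ℂ := fun w => cN ^ (w / 2) * Λ' w * nH w - 2 * cM ^ (w / 2) * Ec w * dH w with hG₂
  have hG₂m : Meromorphic G₂ :=
    (((meromorphic_of_differentiable hpN).mul hΛ').mul (meromorphic_of_differentiable hnH)).sub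
      ((((Meromorphic.const 2).mul (meromorphic_of_differentiable hpM)).mul
        (meromorphic_of_differentiable hEc)).mul (meromorphic_of_differentiable hdH))
  have hG₂z : ∀ w ∈ {w : ℂ | 3 / 2 < w.re}, G₂ w = 0 := fun w hw =>
    sub_eq_zero.mpr (hB2 w hw)
  have hev₂ : ∀ y, ∀ᶠ w in 𝓝[≠] y, G₂ w = 0 :=
    Meromorphic.eventually_eq_zero_of_eqOn_isOpen hG₂m (O := {w : ℂ | 3 / 2 < w.re})
      (isOpen_lt continuous_const Complex.continuous_re) ⟨2, by norm_num⟩ hG₂z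
  have hev₃ : ∀ y, ∀ᶠ w in 𝓝[≠] y, Ec w ≠ 0 := eventually_ne_zero_of_differentiable hEc hw₀
  -- the entire function `Q`
  set Q : ℂ → ℂ := fun s => W * cN ^ ((1 - s) / 2) * cM ^ (s / 2) * nG (1 - s) * dH s -
    a * cM ^ ((1 - s) / 2) * cN ^ (s / 2) * dG (1 - s) * nH s with hQ
  have hQc : Continuous Q :=
    ((((continuous_const.mul hpN'.continuous).mul hpM.continuous).mul hnG'.continuous).mul
      hdH.continuous).sub
      ((((continuous_const.mul hpM'.continuous).mul hpN.continuous).mul hdG'.continuous).mul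
        hnH.continuous)
  refine sub_eq_zero.mp (eq_zero_of_eventually_nhdsNE hQc s ?_)
  filter_upwards [hev₁ s, hev₂ s, hev₃ s] with w h1 h2 h3
  simp only [hG₁, hG₂] at h1 h2
  have h1' := sub_eq_zero.mp h1
  have h2' := sub_eq_zero.mp h2
  have hprod : (2 * Ec w) * Q w = 0 := by
    simp only [hQ]
    linear_combination (cN ^ (w / 2) * nH w) * h1' - (W * cN ^ ((1 - w) / 2) * nG (1 - w)) * h2'
  exact (mul_eq_zero.mp hprod).resolve_left (mul_ne_zero two_ne_zero h3)

/-- **Lemma 4.9 concludes: `M = N`.**  If the cross identity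
`W N^{(1-s)/2} M^{s/2} Num_G(1-s) Den_H(s) = a M^{(1-s)/2} N^{s/2} Den_G(1-s) Num_H(s)` holds for
all `s`, with `N, M > 0`, `a, W ≠ 0`, and finite Euler data `G, H` on a set `S` of primes whose
roots have absolute value `< p^{1/2}`, then `N = M`: with `A = (N/M)^{1/2}` and `ω = a/W` the
identity is (4.9.1) in the cross-multiplied form of `lemma49`, and Lemma 4.9 gives `A = 1`.
Ref: Deligne–Serre 1974, §4 (b) (iv) ("d'où `A = 1`, i.e. `M = N`, ce qui démontre (a)").
[cite: DeligneSerreASENS1974, §4 (b) proof of Thm. 4.6 (iv)] -/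
theorem level_eq_conductor_of_crossIdentity {N' M : ℕ} (hN : 0 < N') (hM : 0 < M) {S : Finset ℕ}
    (hS : ∀ p ∈ S, p.Prime) {G H : ℕ → LFunctions.EulerFactorData}
    (hG : ∀ p ∈ S, ∀ α ∈ (G p).num + (G p).den, ‖α‖ < Real.sqrt p)
    (hH : ∀ p ∈ S, ∀ α ∈ (H p).num + (H p).den, ‖α‖ < Real.sqrt p) {a W : ℂ} (ha : a ≠ 0)
    (hW : W ≠ 0)
    (hQ : ∀ s : ℂ, W * (N' : ℂ) ^ ((1 - s) / 2) * (M : ℂ) ^ (s / 2) * LFunctions.finiteEulerNum S G (1 - s) *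
      LFunctions.finiteEulerDen S H s = a * (M : ℂ) ^ ((1 - s) / 2) * (N' : ℂ) ^ (s / 2) *
        LFunctions.finiteEulerDen S G (1 - s) * LFunctions.finiteEulerNum S H s) :
    N' = M := by
  have hN' : (0 : ℝ) < N' := Nat.cast_pos.mpr hN
  have hM' : (0 : ℝ) < M := Nat.cast_pos.mpr hM
  set A : ℝ := Real.sqrt (N' / M) with hAdef
  have hA : 0 < A := Real.sqrt_pos.mpr (div_pos hN' hM')
  -- `√N`, `√M` as complex numbers
  set α : ℂ := ((Real.sqrt N' : ℝ) : ℂ) with hα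
  set β : ℂ := ((Real.sqrt M : ℝ) : ℂ) with hβ
  have hα0 : α ≠ 0 := ofReal_ne_zero.mpr (Real.sqrt_pos.mpr hN').ne'
  have hβ0 : β ≠ 0 := ofReal_ne_zero.mpr (Real.sqrt_pos.mpr hM').ne'
  have hβarg : β.arg ≠ Real.pi := by
    rw [hβ, Complex.arg_ofReal_of_nonneg (Real.sqrt_nonneg _)]
    exact Real.pi_ne_zero.symm
  have hAeq : (A : ℂ) = α * β⁻¹ := by
    rw [hAdef, Real.sqrt_div' _ hM'.le, hα, hβ]
    push_cast
    ring
  have hApow : ∀ t : ℂ, (A : ℂ) ^ t = α ^ t * (β ^ t)⁻¹ := fun t => by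
    rw [hAeq, hα, hβ, ← ofReal_inv,
      Complex.mul_cpow_ofReal_nonneg (Real.sqrt_nonneg _) (inv_nonneg.mpr (Real.sqrt_nonneg _)),
      ofReal_inv, Complex.inv_cpow _ _ (hβ ▸ hβarg)]
  have hNpow : ∀ t : ℂ, (N' : ℂ) ^ (t / 2) = α ^ t := fun t => by
    rw [hα, ← ofReal_cpow_half hN', ofReal_natCast]
  have hMpow : ∀ t : ℂ, (M : ℂ) ^ (t / 2) = β ^ t := fun t => by
    rw [hβ, ← ofReal_cpow_half hM', ofReal_natCast]
  have hββ : ∀ s : ℂ, β ^ (1 - s) * β ^ s = β := fun s => by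
    rw [← Complex.cpow_add _ _ hβ0, sub_add_cancel, cpow_one]
  have key : ∀ s : ℂ, (A : ℂ) ^ (1 - s) * LFunctions.finiteEulerNum S G (1 - s) * LFunctions.finiteEulerDen S H s =
      a / W * (A : ℂ) ^ s * LFunctions.finiteEulerNum S H s * LFunctions.finiteEulerDen S G (1 - s) := fun s => by
    have h := hQ s
    rw [hNpow, hNpow, hMpow, hMpow] at h
    rw [hApow, hApow]
    have hβt : ∀ t : ℂ, β ^ t ≠ 0 := fun t h0 => hβ0 ((cpow_eq_zero_iff _ _).mp h0).1
    have hβ1 := hβt (1 - s)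
    have hβ2 := hβt s
    field_simp
    linear_combination h
  have h49 := (LFunctions.ModularForms.DeligneSerre1974.lemma49_holds S hS A hA G H hG hH (a / W) (div_ne_zero ha hW) key).1
  -- `A = 1` gives `N = M`
  have hNM : (N' : ℝ) / M = 1 := by
    rwa [hAdef, Real.sqrt_eq_one] at h49
  rw [div_eq_one_iff_eq hM'.ne'] at hNM
  exact_mod_cast hNM

/-! ### Thm. 4.6 (a): assembly -/

/-- For `p ∈ N.primeFactors`: `1 < √p`. [folklore] -/
theorem one_lt_sqrt_of_mem_primeFactors {N p : ℕ} (hp : p ∈ N.primeFactors) :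
    (1 : ℝ) < Real.sqrt p := by
  rw [Real.lt_sqrt zero_le_one, one_pow]
  exact_mod_cast (Nat.prime_of_mem_primeFactors hp).one_lt

/-- **Deligne–Serre 1974, Thm. 4.6 (a) (with Rem. 4.3), proved from the printed inputs of its
proof** (op. cit. pp. 515–516): oddness (Rem. 4.5, `rem45_isOdd`), the weight-one functional
equation (i) (`weightOne_functionalEquation`), the bound 1.8 of the newform
(`IsNewform1.cuspCoeff_of_dvd_level`) and Artin's functional equation (ii)
(`Lang.artin_functional_equation`), threaded as hypotheses (D-0014); the Euler products (1.7.2)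
of `Φ_f` (`IsNewform1.hasProd_cuspFormLSeries_holds_of_weight_one`) and (iii) of `L(s, ρ)`
(`Lang.artinLFunction_eulerProduct_holds`) and Lemma 4.9 (iv) (`lemma49_holds`) are proved.
See the module docstring for the argument.
[cite: DeligneSerreASENS1974, Thm. 4.6 (a) and §4 (b) (i)–(iv)] -/
theorem thm46a_of (hodd : EllipticCurves.ModularForms.DeligneSerre1974.rem45_isOdd (N := N)) (hFE : EllipticCurves.ModularForms.DeligneSerre1974.weightOne_functionalEquation (N := N))
    (h18 : EllipticCurves.ModularForms.IsNewform1.cuspCoeff_of_dvd_level (N := N) (k := 1))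
    (hAFE : Automorphic.artin_functional_equation (K := ℚ)) :
    thm46a_artinConductorNat_eq (N := N) := by
  intro f hf ρ hρ hfin
  classical
  have hN0 : N ≠ 0 := NeZero.ne N
  -- the conductor `M` and the dual `ρ^∨`
  obtain ⟨M, hMdef⟩ : ∃ M : ℕ, GaloisRepresentations.GaloisRep.artinConductorNat ρ.toGaloisRep = M := ⟨_, rfl⟩
  have hM0 : M ≠ 0 := hMdef ▸ GaloisRepresentations.GaloisRep.artinConductorNat_ne_zero ρ.toGaloisRep
  obtain ⟨ρd, hρd⟩ : ∃ ρd : GaloisRepresentations.FramedGaloisRep ℚ ℂ 2, GaloisRepresentations.FramedRep.dual ρ = ρd := ⟨_, rfl⟩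
  have hfind : (Set.range ρd).Finite := hρd ▸ GaloisRepresentations.FramedRep.finite_range_dual ρ hfin
  have hMd : GaloisRepresentations.GaloisRep.artinConductorNat ρd.toGaloisRep = M := by
    rw [← hρd, ← hMdef]
    exact GaloisRepresentations.FramedGaloisRep.artinConductorNat_dual ρ hfin
  have hoddρ : ρ.IsOdd := hodd hf ρ hρ hfin
  have hoddd : ρd.IsOdd := hρd ▸ GaloisRepresentations.FramedGaloisRep.isOdd_dual hoddρ
  have hfinA : (Set.range (GaloisRepresentations.FramedArtinRep.toArtinRep ρ :
      absoluteGaloisGroup ℚ → (Fin 2 → ℂ) →ₗ[ℂ] (Fin 2 → ℂ))).Finite :=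
    (GaloisRepresentations.FramedRep.finite_range_toContinuousRep_iff ρ).mpr hfin
  have hfinAd : (Set.range (GaloisRepresentations.FramedArtinRep.toArtinRep ρd :
      absoluteGaloisGroup ℚ → (Fin 2 → ℂ) →ₗ[ℂ] (Fin 2 → ℂ))).Finite :=
    (GaloisRepresentations.FramedRep.finite_range_toContinuousRep_iff ρd).mpr hfind
  -- roots of the Euler factors (roots of unity)
  choose B hB using fun v =>
    GaloisRepresentations.ArtinRep.exists_eval_eulerFactorAt_eq_prod (GaloisRepresentations.FramedArtinRep.toArtinRep ρ) hfinA v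
  choose Bd hBd using fun v =>
    GaloisRepresentations.ArtinRep.exists_eval_eulerFactorAt_eq_prod (GaloisRepresentations.FramedArtinRep.toArtinRep ρd) hfinAd v
  have hB1 : ∀ v, ∀ β ∈ B v, ‖β‖ = 1 := fun v => (hB v).1
  have hBd1 : ∀ v, ∀ β ∈ Bd v, ‖β‖ = 1 := fun v => (hBd v).1
  have hB2 : ∀ v z, ((GaloisRepresentations.FramedArtinRep.toArtinRep ρ).eulerFactorAt v).eval z =
      ((B v).map fun β => 1 - β * z).prod := fun v => (hB v).2
  have hBd2 : ∀ v z, ((GaloisRepresentations.FramedArtinRep.toArtinRep ρd).eulerFactorAt v).eval z =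
      ((Bd v).map fun β => 1 - β * z).prod := fun v => (hBd v).2
  -- the finite Euler data `G`, `H` of Lemma 4.9 on `S = N.primeFactors`
  have hS : ∀ p ∈ N.primeFactors, p.Prime := fun p hp => Nat.prime_of_mem_primeFactors hp
  have hS0 : ∀ p ∈ N.primeFactors, p ≠ 0 := fun p hp => (hS p hp).ne_zero
  obtain ⟨G, hGdef⟩ : ∃ G : ℕ → LFunctions.EulerFactorData,
      G = fun p => ⟨B (Rat.placeOf p), {EllipticCurves.ModularForms.cuspCoeff f p}⟩ := ⟨_, rfl⟩
  obtain ⟨H, hHdef⟩ : ∃ H : ℕ → LFunctions.EulerFactorData,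
      H = fun p => ⟨Bd (Rat.placeOf p), {(starRingEnd ℂ) (EllipticCurves.ModularForms.cuspCoeff f p)}⟩ := ⟨_, rfl⟩
  have hnumG : ∀ (p : ℕ) (s : ℂ), (G p).numFun p s = eulerEval ρ p s := fun p s => by
    simp only [LFunctions.EulerFactorData.numFun, hGdef, eulerEval, hB2, LFunctions.eulerTerm]
  have hnumH : ∀ (p : ℕ) (s : ℂ), (H p).numFun p s = eulerEval ρd p s := fun p s => by
    simp only [LFunctions.EulerFactorData.numFun, hHdef, eulerEval, hBd2, LFunctions.eulerTerm]
  have hdenG : ∀ (p : ℕ) (s : ℂ), (G p).denFun p s = 1 - EllipticCurves.ModularForms.cuspCoeff f p * (p : ℂ) ^ (-s) :=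
    fun p s => by simp [LFunctions.EulerFactorData.denFun, hGdef, LFunctions.eulerTerm]
  have hdenH : ∀ (p : ℕ) (s : ℂ),
      (H p).denFun p s = 1 - (starRingEnd ℂ) (EllipticCurves.ModularForms.cuspCoeff f p) * (p : ℂ) ^ (-s) :=
    fun p s => by simp [LFunctions.EulerFactorData.denFun, hHdef, LFunctions.eulerTerm]
  have hNumG : ∀ s, LFunctions.finiteEulerNum N.primeFactors G s = ∏ p ∈ N.primeFactors, eulerEval ρ p s :=
    fun s => Finset.prod_congr rfl fun p _ => hnumG p s
  have hNumH : ∀ s, LFunctions.finiteEulerNum N.primeFactors H s = ∏ p ∈ N.primeFactors, eulerEval ρd p s :=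
    fun s => Finset.prod_congr rfl fun p _ => hnumH p s
  have hDenG : ∀ s, LFunctions.finiteEulerDen N.primeFactors G s =
      ∏ p ∈ N.primeFactors, (1 - EllipticCurves.ModularForms.cuspCoeff f p * (p : ℂ) ^ (-s)) :=
    fun s => Finset.prod_congr rfl fun p _ => hdenG p s
  have hDenH : ∀ s, LFunctions.finiteEulerDen N.primeFactors H s =
      ∏ p ∈ N.primeFactors, (1 - (starRingEnd ℂ) (EllipticCurves.ModularForms.cuspCoeff f p) * (p : ℂ) ^ (-s)) :=
    fun s => Finset.prod_congr rfl fun p _ => hdenH p s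
  -- the bounds `|β| = 1 < √p`, `|a_p| ≤ 1 < √p` of (iv)
  have hap : ∀ p ∈ N.primeFactors, ‖EllipticCurves.ModularForms.cuspCoeff f p‖ ≤ 1 := fun p hp =>
    EllipticCurves.ModularForms.IsNewform1.norm_cuspCoeff_le_one_of_dvd_level h18 hf (hS p hp) (Nat.dvd_of_mem_primeFactors hp)
  have hG : ∀ p ∈ N.primeFactors, ∀ α ∈ (G p).num + (G p).den, ‖α‖ < Real.sqrt p := by
    intro p hp α hα
    have h1 := one_lt_sqrt_of_mem_primeFactors hp
    simp only [hGdef, Multiset.mem_add, Multiset.mem_singleton] at hα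
    rcases hα with hα | rfl
    · rw [hB1 _ α hα]; exact h1
    · exact lt_of_le_of_lt (hap p hp) h1
  have hH : ∀ p ∈ N.primeFactors, ∀ α ∈ (H p).num + (H p).den, ‖α‖ < Real.sqrt p := by
    intro p hp α hα
    have h1 := one_lt_sqrt_of_mem_primeFactors hp
    simp only [hHdef, Multiset.mem_add, Multiset.mem_singleton] at hα
    rcases hα with hα | rfl
    · rw [hBd1 _ α hα]; exact h1
    · rw [Complex.norm_conj]; exact lt_of_le_of_lt (hap p hp) h1
  -- nonvanishing of the bad factors for `re s > 0`
  have hE0 : ∀ {s : ℂ}, 0 < s.re → ∀ p ∈ N.primeFactors, eulerEval ρ p s ≠ 0 := by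
    intro s hs p hp
    rw [← hnumG]
    simp only [LFunctions.EulerFactorData.numFun, hGdef]
    refine Multiset.prod_ne_zero fun h0 => ?_
    obtain ⟨β, hβ, hβ0⟩ := Multiset.mem_map.mp h0
    exact eulerTerm_ne_zero_of_norm_le_one (hS p hp).two_le (hB1 _ β hβ).le hs hβ0
  have hEd0 : ∀ {s : ℂ}, 0 < s.re → ∀ p ∈ N.primeFactors, eulerEval ρd p s ≠ 0 := by
    intro s hs p hp
    rw [← hnumH]
    simp only [LFunctions.EulerFactorData.numFun, hHdef]
    refine Multiset.prod_ne_zero fun h0 => ?_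
    obtain ⟨β, hβ, hβ0⟩ := Multiset.mem_map.mp h0
    exact eulerTerm_ne_zero_of_norm_le_one (hS p hp).two_le (hBd1 _ β hβ).le hs hβ0
  have hc0 : ∀ {s : ℂ}, 0 < s.re → ∀ p ∈ N.primeFactors, 1 - EllipticCurves.ModularForms.cuspCoeff f p * (p : ℂ) ^ (-s) ≠ 0 :=
    fun {s} hs p hp => eulerTerm_ne_zero_of_norm_le_one (hS p hp).two_le (hap p hp) hs
  have hcc0 : ∀ {s : ℂ}, 0 < s.re → ∀ p ∈ N.primeFactors,
      1 - (starRingEnd ℂ) (EllipticCurves.ModularForms.cuspCoeff f p) * (p : ℂ) ^ (-s) ≠ 0 := fun {s} hs p hp =>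
    eulerTerm_ne_zero_of_norm_le_one (hS p hp).two_le (by rw [Complex.norm_conj]; exact hap p hp) hs
  -- (i) and (ii): the functional equations
  obtain ⟨a, ha0, Ef, hEf, Ec, hEc, hfe⟩ := hFE hf
  obtain ⟨Λ, Λ', hΛm, hΛ'm, hagreeΛ, W, hW1, hFEA⟩ := hAFE ρ
  rw [hρd] at hagreeΛ
  have hW0 : W ≠ 0 := by
    rintro rfl
    simp at hW1
  -- (iii): (B1) and (B2) on `re s > 3/2`
  have hB1' : ∀ s : ℂ, 3 / 2 < s.re → (N : ℂ) ^ (s / 2) * Λ s * LFunctions.finiteEulerNum N.primeFactors G s =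
      2 * (M : ℂ) ^ (s / 2) * Ef s * LFunctions.finiteEulerDen N.primeFactors G s := by
    intro s hs
    have hs1 : 1 < s.re := by linarith
    have hs0 : 0 < s.re := by linarith
    have hs' : ((1 : ℤ) : ℝ) / 2 + 1 < s.re := by push_cast; linarith
    have hA1 := artin_mul_prod_eq (N := N) (c := EllipticCurves.ModularForms.cuspCoeff f)
      (e := fun p => EllipticCurves.ModularForms.nebentypus f (p : ZMod N))
      (hasProd_eulerEval ρ hs1) (hasProd_newformEulerEval hf hs)
      (fun p hp hpN => eulerEval_eq_newformEulerEval hρ hp hpN s)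
      (fun p hp hpN => Automorphic.dirichletCharacter_apply_eq_zero_of_prime_dvd (EllipticCurves.ModularForms.nebentypus f) hp hpN)
      (hE0 hs0) (hc0 hs0)
    rw [(hagreeΛ s hs1).1, GaloisRepresentations.FramedArtinRep.completedArtinLFunction_eq_of_isOdd ρ hoddρ s, hMdef,
      hEf.2 s hs', EllipticCurves.ModularForms.completedCuspFormL, hNumG, hDenG]
    linear_combination (2 * (M : ℂ) ^ (s / 2) * (N : ℂ) ^ (s / 2) * (2 * Real.pi : ℂ) ^ (-s) *
      Complex.Gamma s) * hA1
  have hB2' : ∀ s : ℂ, 3 / 2 < s.re → (N : ℂ) ^ (s / 2) * Λ' s * LFunctions.finiteEulerNum N.primeFactors H s =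
      2 * (M : ℂ) ^ (s / 2) * Ec s * LFunctions.finiteEulerDen N.primeFactors H s := by
    intro s hs
    have hs1 : 1 < s.re := by linarith
    have hs0 : 0 < s.re := by linarith
    have hs' : ((1 : ℤ) : ℝ) / 2 + 1 < s.re := by push_cast; linarith
    have hA2 := artin_mul_prod_eq (N := N) (c := fun p => (starRingEnd ℂ) (EllipticCurves.ModularForms.cuspCoeff f p))
      (e := fun p => (starRingEnd ℂ) (EllipticCurves.ModularForms.nebentypus f (p : ZMod N)))
      (hasProd_eulerEval ρd hs1) (hasProd_conjNewformEulerEval hf hs)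
      (fun p hp hpN => by rw [← hρd]; exact eulerEval_dual_eq_conjNewformEulerEval hρ hfin hp hpN s)
      (fun p hp hpN => by
        simp only [Automorphic.dirichletCharacter_apply_eq_zero_of_prime_dvd (EllipticCurves.ModularForms.nebentypus f) hp hpN, map_zero])
      (hEd0 hs0) (hcc0 hs0)
    rw [(hagreeΛ s hs1).2, GaloisRepresentations.FramedArtinRep.completedArtinLFunction_eq_of_isOdd ρd hoddd s, hMd,
      hEc.2 s hs', EllipticCurves.ModularForms.completedConjCuspFormL, hNumH, hDenH]
    linear_combination (2 * (M : ℂ) ^ (s / 2) * (N : ℂ) ^ (s / 2) * (2 * Real.pi : ℂ) ^ (-s) *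
      Complex.Gamma s) * hA2
  -- `Λ_{f̃} ≢ 0`
  have hEc0 : ∃ w, Ec w ≠ 0 := by
    obtain ⟨x, hx, hx0⟩ := exists_conjCuspFormLSeries_ne_zero hf
    refine ⟨x, ?_⟩
    have hx' : ((1 : ℤ) : ℝ) / 2 + 1 < (x : ℂ).re := by rw [ofReal_re]; push_cast; linarith
    rw [hEc.2 x hx', EllipticCurves.ModularForms.completedConjCuspFormL]
    refine mul_ne_zero (mul_ne_zero (mul_ne_zero ?_ ?_) (Complex.Gamma_ne_zero_of_re_pos ?_)) hx0
    · exact fun h0 => hN0 (Nat.cast_eq_zero.mp ((cpow_eq_zero_iff _ _).mp h0).1)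
    · intro h0
      have := ((cpow_eq_zero_iff _ _).mp h0).1
      simp [Real.pi_ne_zero] at this
    · rw [ofReal_re]; linarith
  -- (iii)–(iv): eliminate the L-functions, then Lemma 4.9
  have hX := crossIdentity_of_functionalEquations (cN := (N : ℂ)) (cM := (M : ℂ))
    (Nat.cast_ne_zero.mpr hN0) (Nat.cast_ne_zero.mpr hM0) hΛ'm hEc.1
    (differentiable_finiteEulerNum hS0 G) (differentiable_finiteEulerDen hS0 G)
    (differentiable_finiteEulerNum hS0 H) (differentiable_finiteEulerDen hS0 H) hB1' hB2' hFEA hfe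
    hEc0
  rw [hMdef]
  exact (level_eq_conductor_of_crossIdentity (Nat.pos_of_ne_zero hN0) (Nat.pos_of_ne_zero hM0) hS
    hG hH ha0 hW0 hX).symm

end DeligneSerre1974

end ModularForms

/-! ### The named fact `artinConductorNat_eq_level` -/

section Lang

open EllipticCurves.ModularForms ModularForms ModularForms.DeligneSerre1974 EllipticCurves.ModularForms.DeligneSerre1974 LFunctions.ModularForms.DeligneSerre1974

variable {N : ℕ} [NeZero N] {f : CuspForm (Gamma1 N) 1} {ρ : GaloisRepresentations.FramedArtinRep ℚ 2}

/-- **`artinConductorNat_eq_level` from the printed inputs of Deligne–Serre's proof of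
Thm. 4.6** (`thm46a_of` with `artinConductorNat_eq_level_of`; the finite-image hypothesis of
the source is discharged by `ArtinRep.finite_range_holds`).
[cite: DeligneSerreASENS1974, Thm. 4.6 (a) and Rem. 4.3] -/
theorem artinConductorNat_eq_level_of' (hodd : rem45_isOdd (N := N))
    (hFE : weightOne_functionalEquation (N := N))
    (h18 : IsNewform1.cuspCoeff_of_dvd_level (N := N) (k := 1))
    (hAFE : artin_functional_equation (K := ℚ)) :
    artinConductorNat_eq_level (f := f) (ρ := ρ) :=
  artinConductorNat_eq_level_of (thm46a_of hodd hFE h18 hAFE)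

end Lang

end Literature.NumberTheory.Automorphic
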